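import Summits.RiemannHypothesis.RiemannHypothesis.Theses.WeilComb
import Summits.RiemannHypothesis.RiemannHypothesis.Theorems.WeilCombCombShapePositivityFejerOfCrux
import Summits.RiemannHypothesis.RiemannHypothesis.Theorems.WeilCombCombShapePositivityStubFejerConvSquare
import Literature.NumberTheory.LFunctions.WeilExplicit
import Literature.NumberTheory.LFunctions.WeilMellinBounds

/-!
# `FejerDivisorPositivity` — the RH-equivalent reformulation "Fejér divisor-sum positivity", named
(crux `WeilComb.CombShapePositivity`, item stmt-RiemannHypothesis-11229, route route-RiemannHypothesis-WeilComb;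
human ruling 2026-08-16 on the residual stub `stub_fejer` of line `Sketch`)

The siege of `CombShapePositivity` isolated one residual statement, registered inline as the stub
`stub_fejer` ("C⁺") of the skeleton `Cruxes/CombShapePositivity/Lines/Sketch.lean` and kernel-proved
EQUIVALENT to `RiemannHypothesis` (`WeilCombFejerConvSquare.fejer_iff_riemannHypothesis`). This file gives
that statement a NAME, `FejerDivisorPositivity` (an `@[conjecture] def`, CONVENTIONS §4 / D-0014: an
unproved statement is a `Prop`, never a theorem), so that routes and skeletons can carry it as what it is —
an RH-equivalent CRUX, "RH in Bohr–Fejér coordinates" — rather than as a support stub, and re-exports the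
closed facts about it under the name:

* `fejerDivisorPositivity_iff_riemannHypothesis : FejerDivisorPositivity ↔ RiemannHypothesis` (unconditional);
* `combShapePositivity_iff_fejerDivisorPositivity : CombShapePositivity ↔ FejerDivisorPositivity`;
* the known direction RH ⇒ `FejerDivisorPositivity` is `fejerDivisorPositivity_iff_riemannHypothesis.mpr`
  (each divisor comb is a Weil test; Weil positivity under RH);
* `fejerDivisorPositivity_subcritical` — the unconditional corner `ε · N ≤ c₀` (Theorem A in Bohr coordinates);
The Fejér reading — the box form equals `Σ_{k ∈ [−n,n]^S} (∏_p (n+1−|k_p|)) w_ε(⟨k, log p⟩) e^{i⟨k,θ⟩}`, the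
order-`n` Fejér mean of the comb symbol restricted to the lattice `⊕_{p∈S} ℤ log p` — is the tree identity
`WeilCombFejerBoxIdentity.stubFejer_lhs_eq_fejerSum` (and `stubFejer_lhs_single_prime` for `|S| = 1`).

## The statement in words

Fix the bump `φ₀(u) = expNegInvGlue (1 - u²)` (support `[-1,1]`), `φ_ε(t) = ε⁻¹ φ₀(t/ε)`, `ψ_ε = φ_ε ⋆ φ̃_ε`,
and the comb symbol `w_ε(x) = W(τ_x ψ_ε)` (Weil's explicit-formula functional on the translate; real, even).
For a finite set of primes `S`, `n : ℕ`, `θ : S → ℝ`, `N = ∏_{p∈S} p^n`, `χ_θ(d) = exp(i Σ_p θ_p v_p(d))`: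
`0 ≤ Re Σ_{d,d' ∣ N} χ_θ(d) conj χ_θ(d') w_ε(log d − log d')`. Readings: (Weil) `= W(G ⋆ G̃)` for the divisor
comb `G = Σ_{d∣N} χ_θ(d) φ_ε(· − log d)` (`fejer_sum_eq_weilQuadratic_divisorComb`); (Fejér) `= (n+1)^{|S|} ×`
the order-`n` Fejér mean at `θ` of the formal Fourier series of `k ↦ w_ε(⟨k, log p⟩)` on `T^S`;
(Bochner–Herglotz) for fixed `ε, S` the family over `n, θ` says `k ↦ w_ε(⟨k, log p⟩)` is positive-definite on
`ℤ^S`; over all `S`, that `q ↦ w_ε(log q)` is positive-definite on the discrete group `ℚ^×_{>0} ≅ ⊕_p ℤ`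
(dual: the infinite torus `∏_p T`, Bohr). Under RH the representing measure on `T^S` is the push-forward
`Σ_γ |Φ₀(εγ)|² δ_{(γ log p mod 2π)_{p∈S}}` of the smoothed zero measure under the Kronecker embedding.

## Provenance / novelty (searched 2026-08-16)

Weil 1952 (RH ⟺ the explicit-formula distribution is of positive type), Bombieri 2000 (Lincei) Thm 2
(ζ-only form), Yoshida 1992 (Hermitian forms on `K(a)`), Li 1997 / Bombieri–Lagarias 1999, Báez-Duarte /
Burnol (Nyman–Beurling), Connes 1999 (semi-local trace formula: restricts the PLACES entering `W`, not the
translation lattice of the tests): the divisor-box / Fejér-mean form is not stated in any of them. As an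
EQUIVALENCE it is folklore-level (Weil's criterion + Herglotz–Bochner on `⊕_p ℤ` via Fejér means, Rudin
*Fourier analysis on groups* §1.4.3 / Thm 1.9.2 + density of `log ℚ_{>0}` and `C¹`-continuity of `W`); what is
new is the coordinate system (finite Euler products `∏_{p∈S} Σ_{k≤n} e^{ikθ_p} p^{−ks}` are a COMPLETE family of
test vectors for fixed-shape comb positivity). Full census: `Cruxes/CombShapePositivity/STRATEGY-CENSUS.md` Part II.
-/

noncomputable section

-- the sub-problem path RiemannHypothesis/RiemannHypothesis duplicates a namespace (D-0017)
set_option linter.dupNamespace false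

open scoped BigOperators ComplexConjugate
open Complex

namespace Summit.RiemannHypothesis.RiemannHypothesis.Theorems

open Literature.NumberTheory.LFunctions
open Summit.RiemannHypothesis.RiemannHypothesis.Theses.WeilComb

/-- OPEN CONJECTURE — **Fejér divisor-sum positivity** [status: open]: for every `ε > 0`, every finite set of
primes `S`, every `n : ℕ` and `θ : ℕ → ℝ`, with `N = ∏_{p∈S} p^n`,
`0 ≤ Re Σ_{d ∣ N} Σ_{d' ∣ N} χ_θ(d) conj(χ_θ(d')) W(τ_{log d − log d'} (φ_ε ⋆ φ̃_ε))`,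
`φ_ε(t) = ε⁻¹ expNegInvGlue (1 − (t/ε)²)`, `χ_θ(d) = exp(i Σ_{p∈S} θ_p v_p(d))` — the Fejér means of the comb
symbol on every torus `T^S` are nonnegative; equivalently Weil's quadratic functional is `≥ 0` on every
Bohr-twisted divisor comb. Literally the registered signature of `stub_fejer` (line `Sketch`). EQUIVALENT TO
`RiemannHypothesis` (`fejerDivisorPositivity_iff_riemannHypothesis`, unconditional), hence an RH-equivalent
crux and never a support lemma; use only as a hypothesis `(h : FejerDivisorPositivity)`. POSED in the siege of
crux stmt-RiemannHypothesis-11229 (2026-08-16); underlying criterion: Weil 1952 / Bombieri 2000 Thm 2. [folklore] -/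
@[conjecture] def FejerDivisorPositivity : Prop :=
  ∀ ε : ℝ, 0 < ε → ∀ S : Finset ℕ, (∀ p ∈ S, p.Prime) → ∀ (n : ℕ) (θ : ℕ → ℝ),
    0 ≤ (∑ d ∈ (∏ p ∈ S, p ^ n).divisors, ∑ d' ∈ (∏ p ∈ S, p ^ n).divisors,
      Complex.exp (I * ((∑ p ∈ S, θ p * (d.factorization p : ℝ) : ℝ) : ℂ)) *
        conj (Complex.exp (I * ((∑ p ∈ S, θ p * (d'.factorization p : ℝ) : ℝ) : ℂ))) *
        weilFunctional (weilTranslate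
          (weilConv (fun t : ℝ => (ε : ℂ)⁻¹ * ((expNegInvGlue (1 - (t / ε) ^ 2) : ℝ) : ℂ))
            (weilReflect (fun t : ℝ => (ε : ℂ)⁻¹ * ((expNegInvGlue (1 - (t / ε) ^ 2) : ℝ) : ℂ))))
          (Real.log (d : ℝ) - Real.log (d' : ℝ)))).re

/-- **Fejér divisor-sum positivity ⟺ RH**, unconditionally: the named form of
`WeilCombFejerConvSquare.fejer_iff_riemannHypothesis` (Gram identity + Bohr–Fejér product-vector reduction
+ two-node detection `combShapeDetection_proof` + Weil positivity under RH). [folklore] -/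
theorem fejerDivisorPositivity_iff_riemannHypothesis : FejerDivisorPositivity ↔ RiemannHypothesis :=
  WeilCombFejerConvSquare.fejer_iff_riemannHypothesis

/-- **The crux in Bohr–Fejér coordinates**: `WeilComb.CombShapePositivity ⟺ FejerDivisorPositivity`
(named form of `WeilCombBohrFejer.combShapePositivity_iff_fejer`). [folklore] -/
theorem combShapePositivity_iff_fejerDivisorPositivity : CombShapePositivity ↔ FejerDivisorPositivity :=
  WeilCombBohrFejer.combShapePositivity_iff_fejer

/-- **The unconditional corner** (Theorem A of the route in Bohr coordinates; named form of
`WeilCombBohrFejer.fejer_subcritical`): there is a universal `c₀ > 0` such that the Fejér divisor sum at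
`(ε, S, n, θ)` is nonnegative whenever `ε · N ≤ c₀`, `N = ∏_{p∈S} p^n`. [folklore] -/
theorem fejerDivisorPositivity_subcritical :
    ∃ c₀ : ℝ, 0 < c₀ ∧ ∀ ε : ℝ, 0 < ε → ∀ S : Finset ℕ, (∀ p ∈ S, p.Prime) → ∀ (n : ℕ) (θ : ℕ → ℝ),
      ε * ((∏ p ∈ S, p ^ n : ℕ) : ℝ) ≤ c₀ →
      0 ≤ (∑ d ∈ (∏ p ∈ S, p ^ n).divisors, ∑ d' ∈ (∏ p ∈ S, p ^ n).divisors,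
        Complex.exp (I * ((∑ p ∈ S, θ p * (d.factorization p : ℝ) : ℝ) : ℂ)) *
          conj (Complex.exp (I * ((∑ p ∈ S, θ p * (d'.factorization p : ℝ) : ℝ) : ℂ))) *
          weilFunctional (weilTranslate
            (weilConv (fun t : ℝ => (ε : ℂ)⁻¹ * ((expNegInvGlue (1 - (t / ε) ^ 2) : ℝ) : ℂ))
              (weilReflect (fun t : ℝ => (ε : ℂ)⁻¹ * ((expNegInvGlue (1 - (t / ε) ^ 2) : ℝ) : ℂ))))
            (Real.log (d : ℝ) - Real.log (d' : ℝ)))).re :=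
  WeilCombBohrFejer.fejer_subcritical

end Summit.RiemannHypothesis.RiemannHypothesis.Theorems

end
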